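import Literature.NumberTheory.ComplexMultiplication.WeilTorusToOrbitToriInjective
import HarnessLib

/-!
# Milne 1999 §4: `W^K_{1,+}(pⁿ)`, `W^K_{1,+}(p^∞)` and the isomorphism
# `[π] ↦ f_π : W^K_{1,+}(p^∞) ≅ {f : Y → ℤ | f(w) + f(ιw) = [K_w : ℚ_p], f(w) ≥ 0}`; Remark 5.2 (c) for `α^K : P^K → S^K`
# (J. S. Milne, *Lefschetz motives and the Tate conjecture*, Compositio Math. 117 (1999), §4 p. 61 L27–L29, §5 p. 63 Rem. 5.2 (c))

Family `hodge`, lane `lit-hodgefound` (Layer A3; seat `lit-hodgefound-p27`, generation 16, row g16-#5); topic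
`Literature/NumberTheory/ComplexMultiplication`, namespace `Literature.NumberTheory.ComplexMultiplication.CMNumbers`.  TENTH FILE of the
seat's Milne-1999 series; sequel of g16-#4 `WeilTorusToOrbitToriInjective` (`weilLimitInOnePlus = W^K_{1,+}(p^∞)`, `pGermIn = p^K`,
`pCharIn`), g16-#3 `WeilTorusToSerreGroupSurjective` (`fInvLim = ([π] ↦ f_π)` on `W^K(p^∞)`, `fInvLimEquiv` = Remark 5.2 (b), `admissibleFuns`,
`alphaCharIn`/`alphaPointsIn = α^K`), g16-#1 `WeilNumberPrimeInvariants` (`fInv = f_π`, `fInvHom`, `weilGroupIn = W^K(pⁿ)`, `toWeilGroup`,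
`IsWeilNumberIn.fInv_add_fInv_complexConj_smul`, `IsWeilNumberIn.isIntegral_of_forall_primeOrd_nonneg`) and g15-#2/#3 (`weilOnePlus = W_{1,+}(pⁿ)`,
`weilLimOnePlus = W_{1,+}(p^∞)`, `weilGerm_eq_weilGerm_iff`).  ONE small carrier with body (`onePlusFuns`, Milne's target set) and one `Equiv`
(`fInvLimOnePlusEquiv`) + THEOREMS; no named fact (D-0026, net debt 0).

THE PRINT.  [Milne1999] §4 p. 61 L27–L29 (held `paper:doi-10-1023-a-1000776613765` p0017), verbatim, after the definition of `W^K(pⁿ)`,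
`W^K(p^∞)` and of `[π] ↦ f_π` (g16-#1, g16-#3): «Define `W^K_{1,+}(pⁿ)` and `W^K_{1,+}(p^∞)` similarly. Then `[π] ↦ f_π` defines an
isomorphism `W^K_{1,+}(p^∞) ≅ {f : Y → ℤ | f(w) + f(ιw) = [K_w : ℚ_p], f(w) ≥ 0}`.»  (p. 60 L11–L12: «Let `W_{1,+}(pⁿ)` be the subset of
`W(pⁿ)` consisting of those `π` that are of weight `−1` and are algebraic integers, and let `W_{1,+}(p^∞) = lim→ W_{1,+}(pⁿ)`.»)  §5 p. 63
Remark 5.2 (c) (p0019): «The homomorphism `α^K : P^K → S^K` sends `p^K` to `s^K`.»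

THE PROOF HERE.  For `π ∈ W^K(pⁿ)` of exponent `m` (`π·ιπ = (pⁿ)^m`, weight `−m`) g16-#1 gives `f_π(w) + f_π(ιw) = m·[K_w : ℚ_p]`, so
«weight `−1`» ⟺ «`f_π + ιf_π = [K_w : ℚ_p]`» (`isWeilNumberIn_one_iff_forall_fInvHom_add`); and `f_π(w) = ord_w(π)·f(w/p)/n` has the sign of
`ord_w(π)`, while a Weil `pⁿ`-number is integral iff `ord_w(π) ≥ 0` at the primes over `p` (g16-#1), so «algebraic integer» ⟺ «`f_π ≥ 0`»
(`isIntegral_iff_forall_fInvHom_nonneg`).  Hence `W^K_{1,+}(pⁿ)` is cut out by the two conditions (`toWeilGroup_mem_weilOnePlus_iff`), and so is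
`W^K_{1,+}(p^∞)` (`mem_weilLimitInOnePlus_iff_fInvLim`; the passage to germs uses that `W_{1,+}` is saturated for the germ equivalence,
`toWeilGroup_mem_weilOnePlus_of_weilGerm_mem`).  The isomorphism is then the restriction of Remark 5.2 (b) (g16-#3 `fInvLimEquiv`, whose
surjectivity is Lemma 5.1) to these subsets (`fInvLimOnePlusEquiv`).  Since `0 ≤ f ≤ [K_w : ℚ_p]` on the right, `W^K_{1,+}(p^∞)` is FINITE
(`weilLimitInOnePlus_finite`) — so `L^K = ∏_{Π ∈ Γ\W^K_{1,+}(p^∞)} L^Π` of p. 62 is a finite product.  Remark 5.2 (c) at level `K` is g15-#5's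
`X^*(α^K)(s^K) = [p]` read in `X^*(P^K) = W^K(p^∞)`.

DICTIONARY.  As in g16-#1…#4 (`K` CM, Galois over `ℚ` where marked; `Y = primesOverSet p K`; `ι` on `Y` is `conjGal`;
`[K_w : ℚ_p] = localDegree w`; `f_π = fInv`/`fInvHom`/`fInvLim`; `W_{1,+}(pⁿ) = weilOnePlus p n ⊂ W(pⁿ)`, read on `W^K(pⁿ) = weilGroupIn K p n`
along `toWeilGroup τ₀`; `W^K_{1,+}(p^∞) = weilLimitInOnePlus K p τ₀`); Milne's set `{f : Y → ℤ | f(w) + f(ιw) = [K_w : ℚ_p], f(w) ≥ 0}` =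
`onePlusFuns K p`; `s^K` = Q768's `constChar … 1 ∈ X^*(S^K)`, on points `torusPoints.eval … (constChar … 1)`; `p^K = pGermIn`/`pCharIn` (g16-#4).

WHAT IS HERE (all PROVED):
* §1 (level `pⁿ`, `n ≥ 1`) `fInv_nonneg_iff`, **`isIntegral_iff_forall_fInvHom_nonneg`** (integral ⟺ `f_π ≥ 0`), `isIntegral_map_iff`,
  **`isWeilNumberIn_one_iff_forall_fInvHom_add`** (weight `−1` ⟺ `f_π + ιf_π = [K_w : ℚ_p]`), **`toWeilGroup_mem_weilOnePlus_iff`**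
  (`W^K_{1,+}(pⁿ)` through the invariants).
* §2 **`toWeilGroup_mem_weilOnePlus_of_weilGerm_mem`** (`W_{1,+}` is germ-saturated), **`mem_weilLimitInOnePlus_iff_fInvLim`** (`W^K_{1,+}(p^∞)`
  through the invariants), DEF **`onePlusFuns K p`** (`mem_onePlusFuns_iff`, `onePlusFuns_subset_admissibleFuns`, `toAdd_fInvLim_mem_onePlusFuns`,
  `onePlusFuns_finite`), DEF **`fInvLimOnePlusEquiv : W^K_{1,+}(p^∞) ≃ onePlusFuns K p`** — THE PRINTED ISOMORPHISM (`coe_fInvLimOnePlusEquiv`),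
  **`weilLimitInOnePlus_finite`**, `orbits_weilLimitInOnePlus_finite`.
* §3 **`alphaCharIn_constChar_one : X^*(α^K)(s^K) = p^K`**, **`eval_constChar_alphaPointsIn`** (REMARK 5.2 (c): `s^K ∘ α^K = p^K` on `P^K(R)`).

NOT here: p. 62 L1–L10 («`inv_w(End⁰(A) ⊗ K) = f_{ρ(π)}(w)`», Tate's theorem; the condition (∗) and `LMot^K(𝔽)`), Prop. 4.1, Thm. 4.3 —
Layer B (B5-09).

## References

* [Milne1999] J. S. Milne, *Lefschetz motives and the Tate conjecture*, Compositio Math. 117 (1999) 45–76 — §4 p. 61 L27–L29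
  (and p. 60 L11–L12, p. 61 L14–L27, p. 62 L11–L13), §5 p. 63 Remark 5.2 (c) (held `paper:doi-10-1023-a-1000776613765` p0016–p0019).
* [Milne2017] J. S. Milne, *Algebraic Groups*, CUP 2017 — Ch. 12 Thm. 12.9 (points of groups of multiplicative type; Q768
  `CharacterModuleTorusPoints`).

Provenance: lane `lit-hodgefound`, seat `lit-hodgefound-p27` gen 16 (agent `literature-prover-lit-hodgefound-p27-g16-0`),
row g16-#5 (INBOX 2026-08-23, claim line recorded in the seat sheet).
-/

set_option autoImplicit false

noncomputable section

open scoped NumberField Pointwise ComplexConjugate TensorProduct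

namespace Literature.NumberTheory.ComplexMultiplication

namespace CMNumbers

open _root_.NumberField IsDedekindDomain Finset
open Literature.NumberTheory.NumberFields (cmNumbers cmNumbersConj coe_cmNumbersConj cmNumbersConj_mul_self cmNumbersConj_comm
  cmNumbersConj_mul_comm)
open Literature.RingTheory.GaloisAlgebras.CharacterModuleTorus (torusPoints galUnits)
open SerreGroupTorus (infinityTypesRep serrePoints constChar)

/-! ### §1 `W^K_{1,+}(pⁿ)`: `π ∈ W^K(pⁿ)` of weight `−1` and integral ⟺ `f_π ≥ 0` and `f_π(w) + f_π(ιw) = [K_w : ℚ_p]` -/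

section Level

variable {K : Type} [Field K] [NumberField K] [IsCMField K]
variable (p : ℕ) [hp : Fact p.Prime] {n : ℕ}
variable (τ₀ : K →ₐ[ℚ] cmNumbers)

omit [IsCMField K] in
/-- `f_π(w)` has the sign of `ord_w(π)` (`f_π(w) = ord_w(π)·f(w/p)/n`, g16-#1 `fInv_eq_div`). [cite: Milne1999, §4 p. 61 L14–L17] -/
theorem fInv_nonneg_iff (hn : n ≠ 0) (w : primesOverSet p K) (π : K) :
    0 ≤ fInv p n w π ↔ 0 ≤ primeOrd (toSpectrum p w) π := by
  have hf : (0 : ℚ) < (w.1.inertiaDeg ℤ : ℚ) := by exact_mod_cast Ideal.inertiaDeg_pos w.1 ℤ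
  have hn' : (0 : ℚ) < (n : ℚ) := by exact_mod_cast Nat.pos_of_ne_zero hn
  rw [fInv_eq_div, mul_div_assoc, mul_nonneg_iff_of_pos_right (div_pos hf hn'), Int.cast_nonneg_iff]

/-- **`π ∈ W^K(pⁿ)` is an algebraic integer iff `f_π(w) ≥ 0` for all `w | p`** (`ord_w(π) ≥ 0` at the primes over `p`; away from
`p` a Weil `pⁿ`-number is a unit — g16-#1 `IsWeilNumberIn.isIntegral_of_forall_primeOrd_nonneg`): the clause «`f(w) ≥ 0`» of
p. 61 L29 is the clause «algebraic integers» of `W_{1,+}`. [cite: Milne1999, §4 p. 60 L11–L12, p. 61 L27–L29] -/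
theorem isIntegral_iff_forall_fInvHom_nonneg (hn : n ≠ 0) (u : weilGroupIn K p n) :
    IsIntegral ℤ ((u : Kˣ) : K) ↔ ∀ w : primesOverSet p K, 0 ≤ (fInvHom u).toAdd w := by
  constructor
  · intro h w
    have h1 : (0 : ℚ) ≤ ((fInvHom u).toAdd w : ℚ) := by
      rw [fInvHom_apply, fInv_nonneg_iff p hn]
      exact primeOrd_nonneg_of_isIntegral _ h
    exact_mod_cast h1
  · intro h
    obtain ⟨m, hm⟩ := u.2.1
    refine hm.isIntegral_of_forall_primeOrd_nonneg fun w => ?_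
    rw [← fInv_nonneg_iff p hn, ← fInvHom_apply]
    exact_mod_cast h w

omit [IsCMField K] in
/-- Integrality is read along the embedding `τ₀ : K → ℚ^{cm}`. [cite: Milne1999, §4 p. 61 L18–L19] -/
theorem isIntegral_map_iff (x : K) : IsIntegral ℤ (τ₀ x) ↔ IsIntegral ℤ x :=
  isIntegral_algHom_iff (τ₀.toRingHom.toIntAlgHom) τ₀.toRingHom.injective

/-- **`π ∈ W^K(pⁿ)` has weight `−1` iff `f_π(w) + f_π(ιw) = [K_w : ℚ_p]` for all `w | p`** (g16-#1 `fInv_add_fInv_complexConj_smul`: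
`f_π(w) + f_π(ιw) = m·[K_w : ℚ_p]` for `π` of weight `−m`): the clause «`f(w) + f(ιw) = [K_w : ℚ_p]`» of p. 61 L29 is the clause
«weight `−1`» of `W_{1,+}`. [cite: Milne1999, §4 p. 60 L11–L12, p. 61 L25–L29] -/
theorem isWeilNumberIn_one_iff_forall_fInvHom_add (hn : n ≠ 0) (u : weilGroupIn K p n) :
    IsWeilNumberIn p n 1 ((u : Kˣ) : K) ↔
      ∀ w : primesOverSet p K, (fInvHom u).toAdd w + (fInvHom u).toAdd ((conjGal : K ≃ₐ[ℚ] K) • w) = localDegree w.1 := by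
  constructor
  · intro h w
    have h1 := h.fInv_add_fInv_complexConj_smul hn w
    rw [← conjGal_smul_primesOver, Int.cast_one, one_mul] at h1
    have h2 : (((fInvHom u).toAdd w + (fInvHom u).toAdd ((conjGal : K ≃ₐ[ℚ] K) • w) : ℤ) : ℚ) = (localDegree w.1 : ℚ) := by
      rw [Int.cast_add, fInvHom_apply, fInvHom_apply, h1]
    exact_mod_cast h2
  · intro h
    obtain ⟨m, hm⟩ := u.2.1
    obtain ⟨w⟩ := nonempty_primesOverSet (K := K) p
    have h1 := hm.fInv_add_fInv_complexConj_smul hn w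
    rw [← conjGal_smul_primesOver, ← fInvHom_apply, ← fInvHom_apply, ← Int.cast_add, h w] at h1
    have h2 : (localDegree w.1 : ℤ) = m * localDegree w.1 := by exact_mod_cast h1
    have hd : (localDegree w.1 : ℤ) ≠ 0 := by exact_mod_cast (localDegree_pos p w).ne'
    have hm1 : m = 1 := by
      have : (1 - m) * (localDegree w.1 : ℤ) = 0 := by rw [sub_mul, one_mul, ← h2, sub_self]
      rcases mul_eq_zero.mp this with h0 | h0
      · omega
      · exact absurd h0 hd
    rwa [hm1] at hm

/-- **«Define `W^K_{1,+}(pⁿ)` … similarly» — `W^K_{1,+}(pⁿ) = W^K(pⁿ) ∩ W_{1,+}(pⁿ)` THROUGH THE INVARIANTS**: `π ∈ W^K(pⁿ)` lies in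
`W_{1,+}(pⁿ)` (g15-#2 `weilOnePlus`, along `τ₀`) iff `f_π ≥ 0` and `f_π(w) + f_π(ιw) = [K_w : ℚ_p]` for all `w`. [cite: Milne1999, §4 p. 61 L27–L29] -/
theorem toWeilGroup_mem_weilOnePlus_iff (hn : n ≠ 0) (u : weilGroupIn K p n) :
    toWeilGroup τ₀ u ∈ weilOnePlus p n ↔
      (∀ w : primesOverSet p K, 0 ≤ (fInvHom u).toAdd w) ∧
        ∀ w : primesOverSet p K, (fInvHom u).toAdd w + (fInvHom u).toAdd ((conjGal : K ≃ₐ[ℚ] K) • w) = localDegree w.1 := by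
  rw [mem_weilOnePlus_iff, coe_toWeilGroup, ← isWeilNumberIn_iff τ₀, isIntegral_map_iff,
    isWeilNumberIn_one_iff_forall_fInvHom_add p hn, isIntegral_iff_forall_fInvHom_nonneg p hn, and_comm]

end Level

/-! ### §2 `W^K_{1,+}(p^∞) ≅ {f : Y → ℤ | f(w) + f(ιw) = [K_w : ℚ_p], f(w) ≥ 0}` -/

section Limit

variable {K : Type} [Field K] [NumberField K] [IsCMField K]
variable (p : ℕ) [hp : Fact p.Prime] (𝔭 : Ideal (𝓞 K)) [h𝔭 : 𝔭.LiesOver (Ideal.span {(p : ℤ)})] [h𝔭P : 𝔭.IsPrime]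
variable (τ₀ : K →ₐ[ℚ] cmNumbers)

/-- `W_{1,+}` is saturated for the germ equivalence: if the germ `[τ₀π]` of `π ∈ W^K(pⁿ)` lies in `W_{1,+}(p^∞) = lim→ W_{1,+}(pⁿ)` then
`τ₀π ∈ W_{1,+}(pⁿ)` already (weights are germ invariants; `(τ₀π)^{a} = π′^{b}` integral forces `τ₀π` integral, Mathlib `IsIntegral.of_pow`).
So the two readings of «`W^K_{1,+}(p^∞)`» — `lim→ (W^K(pⁿ) ∩ W_{1,+}(pⁿ))` and `W^K(p^∞) ∩ W_{1,+}(p^∞)` (g16-#4 `weilLimitInOnePlus`) — agree.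
[cite: Milne1999, §4 p. 60 L11–L12, p. 61 L27–L28] -/
theorem toWeilGroup_mem_weilOnePlus_of_weilGerm_mem {n : ℕ+} (u : weilGroupIn K p n)
    (h : weilGerm n (toWeilGroup τ₀ u) ∈ weilLimOnePlus p) : toWeilGroup τ₀ u ∈ weilOnePlus p n := by
  obtain ⟨n', u', hu', he⟩ := h
  refine ⟨?_, ?_⟩
  · -- weight `−1`
    have hw : weilExp (toWeilGroup τ₀ u) = 1 := by
      rw [← weilLimExp_weilGerm, ← he, weilLimExp_weilGerm]
      exact weilExp_eq_one_of_mem_weilOnePlus hu'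
    rw [← hw]
    exact isWeilNumber_weilExp _
  · -- integrality: `(τ₀π)^{n' k} = π′^{n k}` is integral
    obtain ⟨k, hk, hkk⟩ := (weilGerm_eq_weilGerm_iff (toWeilGroup τ₀ u) u').mp he.symm
    have hu'0 : ((u' : cmNumbersˣ) : cmNumbers) ≠ 0 := (u' : cmNumbersˣ).ne_zero
    have h1 : (((toWeilGroup τ₀ u : weilGroup p n) : cmNumbersˣ) : cmNumbers) ^ ((n' : ℕ) * k) =
        (((u' : cmNumbersˣ) : cmNumbers)) ^ ((n : ℕ) * k) := by
      have h2 := congrArg (fun z : cmNumbersˣ => (z : cmNumbers)) hkk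
      simp only [Units.val_pow_eq_pow_val, Units.val_div_eq_div_val, Units.val_one, div_pow, ← pow_mul] at h2
      rwa [div_eq_one_iff_eq (pow_ne_zero _ hu'0)] at h2
    have hpos : 0 < (n' : ℕ) * k := Nat.mul_pos n'.pos (Nat.pos_of_ne_zero hk)
    refine IsIntegral.of_pow hpos ?_
    rw [h1]
    exact hu'.2.pow _

/-- **`W^K_{1,+}(p^∞)` THROUGH THE INVARIANTS `f_π`**: `[π] ∈ W^K_{1,+}(p^∞)` iff `f_π(w) ≥ 0` and `f_π(w) + f_π(ιw) = [K_w : ℚ_p]` for all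
`w | p` (`f_π = fInvLim [π]`, g16-#3). [cite: Milne1999, §4 p. 61 L27–L29] -/
theorem mem_weilLimitInOnePlus_iff_fInvLim (x : weilLimitIn K p τ₀) :
    (x : WeilLimit p) ∈ weilLimitInOnePlus K p τ₀ ↔
      (∀ w : primesOverSet p K, 0 ≤ (fInvLim p τ₀ x).toAdd w) ∧
        ∀ w : primesOverSet p K,
          (fInvLim p τ₀ x).toAdd w + (fInvLim p τ₀ x).toAdd ((conjGal : K ≃ₐ[ℚ] K) • w) = localDegree w.1 := by
  obtain ⟨n, u, hu⟩ := (mem_weilLimitIn_iff p τ₀ (x : WeilLimit p)).mp x.2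
  have hx : x = ⟨weilGerm n (toWeilGroup τ₀ u), weilGerm_toWeilGroup_mem_weilLimitIn p τ₀ u⟩ := Subtype.ext hu.symm
  subst hx
  rw [fInvLim_mk, ← toWeilGroup_mem_weilOnePlus_iff p τ₀ n.ne_zero u, mem_weilLimitInOnePlus_iff]
  constructor
  · rintro ⟨-, h⟩
    exact toWeilGroup_mem_weilOnePlus_of_weilGerm_mem p τ₀ u h
  · intro h
    exact ⟨weilGerm_toWeilGroup_mem_weilLimitIn p τ₀ u, weilGerm_mem_weilLimOnePlus h⟩

variable (K) in
/-- **Milne's `{f : Y → ℤ | f(w) + f(ιw) = [K_w : ℚ_p], f(w) ≥ 0}`** (with `[K_w : ℚ_p] = localDegree w`, `ι = conjGal` on `Y`). [cite: Milne1999, §4 p. 61 L27–L29] -/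
def onePlusFuns : Set (primesOverSet p K → ℤ) :=
  {f | (∀ w, 0 ≤ f w) ∧ ∀ w, f w + f ((conjGal : K ≃ₐ[ℚ] K) • w) = localDegree w.1}

omit hp in
/-- [cite: Milne1999, §4 p. 61 L27–L29] -/
theorem mem_onePlusFuns_iff (f : primesOverSet p K → ℤ) :
    f ∈ onePlusFuns K p ↔ (∀ w, 0 ≤ f w) ∧ ∀ w, f w + f ((conjGal : K ≃ₐ[ℚ] K) • w) = localDegree w.1 := Iff.rfl

omit hp in
/-- These `f` are admissible in the sense of g16-#3 (`f + ιf = 1·[K_{w₀} : ℚ_p]`; `[K_w : ℚ_p] = [K_{w₀} : ℚ_p]` for `K` Galois,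
g16-#1 `localDegree_eq_of_isGalois`). [cite: Milne1999, §4 p. 61 L25–L29] -/
theorem onePlusFuns_subset_admissibleFuns [IsGalois ℚ K] : onePlusFuns K p ⊆ (admissibleFuns K p 𝔭 : Set (primesOverSet p K → ℤ)) := by
  intro f hf
  rw [SetLike.mem_coe, mem_admissibleFuns_iff]
  refine ⟨1, fun w => ?_⟩
  rw [hf.2 w, one_mul, localDegree_eq_of_isGalois p w (basePrime p 𝔭)]

/-- `f_π` lies in Milne's set for `[π] ∈ W^K_{1,+}(p^∞)`. [cite: Milne1999, §4 p. 61 L27–L29] -/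
theorem toAdd_fInvLim_mem_onePlusFuns {x : weilLimitIn K p τ₀} (hx : (x : WeilLimit p) ∈ weilLimitInOnePlus K p τ₀) :
    (fInvLim p τ₀ x).toAdd ∈ onePlusFuns K p :=
  (mem_weilLimitInOnePlus_iff_fInvLim p τ₀ x).mp hx

/-- **«Then `[π] ↦ f_π` defines an isomorphism `W^K_{1,+}(p^∞) ≅ {f : Y → ℤ | f(w) + f(ιw) = [K_w : ℚ_p], f(w) ≥ 0}`»** (`K` CM,
Galois over `ℚ`): the restriction of REMARK 5.2 (b)'s `fInvLimEquiv : W^K(p^∞) ≅ {admissible f}` (g16-#3) to `W^K_{1,+}(p^∞)`, a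
bijection of SETS (neither side is a group).  Injective by «obviously injective» (g16-#1), onto by Lemma 5.1 (g16-#3 `exists_fInvLim_eq`)
and `mem_weilLimitInOnePlus_iff_fInvLim`. [cite: Milne1999, §4 p. 61 L27–L29] -/
def fInvLimOnePlusEquiv [IsGalois ℚ K] : weilLimitInOnePlus K p τ₀ ≃ onePlusFuns K p where
  toFun x := ⟨(fInvLim p τ₀ ⟨(x : WeilLimit p), x.2.1⟩).toAdd, toAdd_fInvLim_mem_onePlusFuns p τ₀ x.2⟩
  invFun f :=
    ⟨(((fInvLimEquiv p 𝔭 τ₀).symm (Multiplicative.ofAdd ⟨f.1, onePlusFuns_subset_admissibleFuns p 𝔭 f.2⟩) : weilLimitIn K p τ₀) :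
        WeilLimit p), by
      rw [mem_weilLimitInOnePlus_iff_fInvLim p τ₀]
      have h := coe_toAdd_fInvLimEquiv p 𝔭 τ₀
        ((fInvLimEquiv p 𝔭 τ₀).symm (Multiplicative.ofAdd ⟨f.1, onePlusFuns_subset_admissibleFuns p 𝔭 f.2⟩))
      rw [MulEquiv.apply_symm_apply, toAdd_ofAdd] at h
      rw [← h]
      exact f.2⟩
  left_inv x := by
    apply Subtype.ext
    change (((fInvLimEquiv p 𝔭 τ₀).symm _ : weilLimitIn K p τ₀) : WeilLimit p) = x
    have h : Multiplicative.ofAdd (⟨(fInvLim p τ₀ ⟨(x : WeilLimit p), x.2.1⟩).toAdd,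
        onePlusFuns_subset_admissibleFuns p 𝔭 (toAdd_fInvLim_mem_onePlusFuns p τ₀ x.2)⟩ : admissibleFuns K p 𝔭) =
        fInvLimEquiv p 𝔭 τ₀ ⟨(x : WeilLimit p), x.2.1⟩ := by
      apply Multiplicative.toAdd.injective
      apply Subtype.ext
      rw [toAdd_ofAdd, coe_toAdd_fInvLimEquiv]
    rw [h, MulEquiv.symm_apply_apply]
  right_inv f := by
    apply Subtype.ext
    change (fInvLim p τ₀ ⟨_, _⟩).toAdd = f.1
    have h := coe_toAdd_fInvLimEquiv p 𝔭 τ₀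
      ((fInvLimEquiv p 𝔭 τ₀).symm (Multiplicative.ofAdd ⟨f.1, onePlusFuns_subset_admissibleFuns p 𝔭 f.2⟩))
    rw [MulEquiv.apply_symm_apply, toAdd_ofAdd] at h
    exact h.symm

/-- The bijection IS `[π] ↦ f_π`. [cite: Milne1999, §4 p. 61 L27–L29] -/
@[simp] theorem coe_fInvLimOnePlusEquiv [IsGalois ℚ K] (x : weilLimitInOnePlus K p τ₀) :
    ((fInvLimOnePlusEquiv p 𝔭 τ₀ x : onePlusFuns K p) : primesOverSet p K → ℤ) =
      (fInvLim p τ₀ ⟨(x : WeilLimit p), x.2.1⟩).toAdd := rfl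

/-- Milne's set `{f | f + ιf = [K_w : ℚ_p], f ≥ 0}` is finite (`0 ≤ f(w) ≤ [K_w : ℚ_p]`, `Y` finite). [cite: Milne1999, §4 p. 61 L27–L29] -/
theorem onePlusFuns_finite : (onePlusFuns K p).Finite := by
  refine (Set.Finite.pi fun w : primesOverSet p K => Set.finite_Icc (0 : ℤ) (localDegree w.1 : ℤ)).subset ?_
  intro f hf
  rw [Set.mem_univ_pi]
  intro w
  refine ⟨hf.1 w, ?_⟩
  have h := hf.2 w
  have h' := hf.1 ((conjGal : K ≃ₐ[ℚ] K) • w)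
  omega

/-- **`W^K_{1,+}(p^∞)` IS FINITE** — so `Γ\W^K_{1,+}(p^∞)` is finite and `L^K = ∏_{Π ∈ Γ\W^K_{1,+}(p^∞)} L^Π` (p. 62 L11–L13) is a finite
product of tori. [cite: Milne1999, §4 p. 61 L27–L29, p. 62 L11–L13] -/
theorem weilLimitInOnePlus_finite [IsGalois ℚ K] : (weilLimitInOnePlus K p τ₀).Finite := by
  obtain ⟨⟨𝔭, h𝔭⟩⟩ := nonempty_primesOverSet (K := K) p
  haveI := h𝔭.1
  haveI := h𝔭.2
  haveI : Finite (onePlusFuns K p) := (onePlusFuns_finite (K := K) p).to_subtype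
  exact Set.finite_coe_iff.mp (Finite.of_equiv _ (fInvLimOnePlusEquiv p 𝔭 τ₀).symm)

/-- Hence the set `Γ\W^K_{1,+}(p^∞)` of `Γ`-orbits indexing `L^K` is finite. [cite: Milne1999, §4 p. 62 L11–L13] -/
theorem orbits_weilLimitInOnePlus_finite [IsGalois ℚ K] :
    ((fun x : WeilLimit p => MulAction.orbit (cmNumbers ≃ₐ[ℚ] cmNumbers) x) '' weilLimitInOnePlus K p τ₀).Finite :=
  (weilLimitInOnePlus_finite p τ₀).image _

end Limit

/-! ### §3 REMARK 5.2 (c): `α^K : P^K → S^K` sends `p^K` to `s^K` -/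

section RemarkC

variable {K : Type} [Field K] [NumberField K] [IsCMField K] [IsGalois ℚ K]
variable (p : ℕ) [hp : Fact p.Prime] (𝔭 : Ideal (𝓞 K)) [h𝔭 : 𝔭.LiesOver (Ideal.span {(p : ℤ)})] [h𝔭P : 𝔭.IsPrime]
variable (τ₀ : K →ₐ[ℚ] cmNumbers)

/-- **Remark 5.2 (c) on characters at level `K`: `X^*(α^K)(s^K) = p^K`** in `X^*(P^K) = W^K(p^∞)` (g15-#5 `alphaCharOfPrime_constChar_one :
X^*(α^K)(s^K) = [p]` in `W(p^∞)`; g16-#3 `alphaCharIn`, g16-#4 `pGermIn`). [cite: Milne1999, §5 p. 63 Rem. 5.2 (c)] -/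
theorem alphaCharIn_constChar_one :
    alphaCharIn p 𝔭 τ₀ (constChar (cmNumbers ≃ₐ[ℚ] cmNumbers) (K →ₐ[ℚ] cmNumbers) cmNumbersConj 1) =
      Additive.ofMul (pGermIn p τ₀) := by
  apply Additive.toMul.injective
  apply Subtype.ext
  rw [toMul_ofMul, coe_toMul_alphaCharIn, alphaCharOfPrime_constChar_one, toMul_ofMul, coe_pGermIn]

variable (R : Type*) [CommRing R] [Algebra ℚ R]

variable {R} in
/-- **REMARK 5.2 (c): «The homomorphism `α^K : P^K → S^K` sends `p^K` to `s^K`»** — on `R`-points, for every commutative `ℚ`-algebra `R`: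
`s^K(α^K(f)) = p^K(f)` for `f ∈ P^K(R)`, i.e. `α^K : (P^K, p^K) → (S^K, s^K)` is a morphism of pairs (g16-#3 `alphaPointsIn = α^K`, g16-#4
`pCharIn = p^K`; g15-#5 proved it on `P(R)`). [cite: Milne1999, §5 p. 63 Rem. 5.2 (c)] -/
theorem eval_constChar_alphaPointsIn (f : weilTorusInPoints p τ₀ R) :
    torusPoints.eval ℚ cmNumbers R (infinityTypesRep (cmNumbers ≃ₐ[ℚ] cmNumbers) (K →ₐ[ℚ] cmNumbers) cmNumbersConj)
        (constChar (cmNumbers ≃ₐ[ℚ] cmNumbers) (K →ₐ[ℚ] cmNumbers) cmNumbersConj 1) (alphaPointsIn p 𝔭 τ₀ R f) =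
      pCharIn p τ₀ R f :=
  congrArg (fun x : Additive (weilLimitIn K p τ₀) =>
      (f : Multiplicative (Additive (weilLimitIn K p τ₀)) →* (cmNumbers ⊗[ℚ] R)ˣ) (Multiplicative.ofAdd x))
    (alphaCharIn_constChar_one p 𝔭 τ₀)

end RemarkC

end CMNumbers

end Literature.NumberTheory.ComplexMultiplication

end
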